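import Literature.AlgebraicGeometry.Resolution.ProjectiveModels
import Literature.AlgebraicGeometry.Motives.SegreEmbedding
import HarnessLib

/-!
# The join of two projective models

Topic: `Literature/AlgebraicGeometry/Resolution`. The first step of Zariski's patching of two
models (Zariski–Samuel II, Ch. VI §17: the JOIN `J(V, V')` of two models, the model whose local
rings are the joins of pairs of corresponding local rings; Piltant 2013, proof of Prop. 5.1,
Step 2: "let `Z` be the … closure of the graph of `η : X₂ ⋯→ X₁`, so `Z` dominates both `X₁` and
`X₂`"): any two projective models `M₁, M₂` of `K/k` (`ProjModel`, `ProjectiveModels.lean`) are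
dominated by a third one, the schematic closure of the diagonal `K`-point
`Spec K → M₁ ×ₖ M₂`. PROVED:

* `ProjModel.exists_join` — there is a projective model `N` of `K/k` with morphisms of models
  `N → M₁`, `N → M₂`.

Ingredients: products of projective `k`-schemes are projective (Segre,
`Literature.AlgebraicGeometry.Motives.IsProjectiveOver.tensor`); the scheme-theoretic image of
the integral `Spec K` is an integral closed subscheme (`ChowLemmaProof.isIntegral_image`) whose
generic point is the image of `Spec K`; its function field is `K` because already
`𝒪_{M₁,ξ} → K` is an isomorphism and factors through `𝒪_{N,ξ} → K`.

## References

* O. Zariski, P. Samuel, *Commutative Algebra* II, Ch. VI §17 (joins of models).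
  [ZariskiSamuel1960]
* O. Piltant, RACSAM 107 (2013), proof of Prop. 5.1, Step 2.
* V. Cossart, O. Piltant, J. Algebra 529 (2019), proof of Prop. 4.6 (arXiv:1412.0868v1:
  Prop. 4.4), Steps 2–4 (closures of graphs of birational correspondences). [CossartPiltant2019]
-/

noncomputable section

open CategoryTheory CategoryTheory.Limits AlgebraicGeometry TopologicalSpace IsLocalRing
  MonoidalCategory CartesianMonoidalCategory

namespace Literature.AlgebraicGeometry.Resolution

namespace ProjModel

universe u

variable {k K : Type u} [Field k] [Field K] [Algebra k K]

/-- A morphism of commutative rings which is bijective is an isomorphism. [folklore] -/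
theorem isIso_of_bijective {R S : CommRingCat.{u}} (ψ : R ⟶ S) (h : Function.Bijective ψ.hom) :
    IsIso ψ := by
  let e : R ≃+* S := RingEquiv.ofBijective ψ.hom h
  let e' : R ≅ S :=
    { hom := ψ
      inv := CommRingCat.ofHom (e.symm : S →+* R)
      hom_inv_id := by
        ext x
        exact e.symm_apply_apply x
      inv_hom_id := by
        ext y
        exact e.apply_symm_apply y }
  exact e'.isIso_hom

/-- **The join of two projective models** (Zariski–Samuel II, Ch. VI §17; Piltant 2013, proof
of Prop. 5.1, Step 2): two projective models `M₁`, `M₂` of `K/k` are dominated by a projective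
model `N` of `K/k` — the schematic closure of the diagonal `K`-point in `M₁ ×ₖ M₂` — through
morphisms of models `N → M₁`, `N → M₂` (the two projections).
[cite: ZariskiSamuel1960, Ch. VI §17] -/
theorem exists_join (M₁ M₂ : ProjModel k K) :
    ∃ N : ProjModel k K, Nonempty (N.Hom M₁) ∧ Nonempty (N.Hom M₂) := by
  -- the product `Q = M₁ ×ₖ M₂`, projective over `k`
  let P₁ : Motives.SchemeOver k := Over.mk M₁.π
  let P₂ : Motives.SchemeOver k := Over.mk M₂.π
  let Q : Motives.SchemeOver k := P₁ ⊗ P₂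
  have hQ : Motives.IsProjectiveOver Q := M₁.isProjectiveOver.tensor M₂.isProjectiveOver
  obtain ⟨m, ε, hε⟩ := hQ
  haveI := hε
  let s₁ : Q.left ⟶ M₁.X := (fst P₁ P₂).left
  let s₂ : Q.left ⟶ M₂.X := (snd P₁ P₂).left
  have hs₁ : s₁ ≫ M₁.π = Q.hom := Over.w (fst P₁ P₂)
  have hs₂ : s₂ ≫ M₂.π = Q.hom := Over.w (snd P₁ P₂)
  -- the diagonal `K`-point `rl : Spec K → Q`
  let T : Motives.SchemeOver k := Over.mk (Spec.map (CommRingCat.ofHom (algebraMap k K)))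
  let t₁ : T ⟶ P₁ := Over.homMk M₁.gen M₁.gen_π
  let t₂ : T ⟶ P₂ := Over.homMk M₂.gen M₂.gen_π
  let r : T ⟶ Q := lift t₁ t₂
  let rl : Spec (CommRingCat.of K) ⟶ Q.left := r.left
  have hrQ : rl ≫ Q.hom = Spec.map (CommRingCat.ofHom (algebraMap k K)) := Over.w r
  have hr₁ : rl ≫ s₁ = M₁.gen := by
    change (lift t₁ t₂).left ≫ (fst P₁ P₂).left = t₁.left
    rw [← Over.comp_left, lift_fst]
  have hr₂ : rl ≫ s₂ = M₂.gen := by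
    change (lift t₁ t₂).left ≫ (snd P₁ P₂).left = t₂.left
    rw [← Over.comp_left, lift_snd]
  -- its schematic closure `Z`
  haveI : NoetherianSpace (Spec (CommRingCat.of K)) :=
    inferInstanceAs (NoetherianSpace (PrimeSpectrum K))
  haveI : QuasiCompact rl := inferInstance
  haveI : IsIntegral rl.image := ChowLemmaProof.isIntegral_image rl
  let g : Spec (CommRingCat.of K) ⟶ rl.image := rl.toImage
  let c : rl.image ⟶ Q.left := rl.imageι
  have hgc : g ≫ c = rl := Scheme.Hom.toImage_imageι rl
  -- the generic point of `Z` is the image of `Spec K`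
  have hpt : g (closedPoint K) = genericPoint rl.image := by
    have hdense : Dense (Set.range g) := (inferInstance : IsDominant g).denseRange
    have hrange : Set.range g = {g (closedPoint K)} := by
      ext z
      constructor
      · rintro ⟨p, rfl⟩
        rw [eq_closedPoint_of_field p]
        rfl
      · intro hz
        exact ⟨_, hz.symm⟩
    have hgen : IsGenericPoint (g (closedPoint K)) (⊤ : Set rl.image) := by
      change closure {g (closedPoint K)} = (Set.univ : Set rl.image)
      rw [← hrange]
      exact hdense.closure_eq
    exact ((genericPoint_spec rl.image).eq hgen).symm
  -- `𝒪_{Z,ξ} → K` is an isomorphism: `𝒪_{M₁,ξ} → K` is, and factors through it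
  have hiso : IsIso (Scheme.stalkClosedPointTo g) := by
    have e : g ≫ (c ≫ s₁) = M₁.gen := by rw [reassoc_of% hgc, hr₁]
    have h1 : IsIso (Scheme.stalkClosedPointTo (g ≫ (c ≫ s₁))) := by
      rw [e]
      infer_instance
    rw [Scheme.stalkClosedPointTo_comp] at h1
    have hsurj : Function.Surjective (Scheme.stalkClosedPointTo g).hom := by
      obtain ⟨w, -, hw⟩ := h1.out
      intro y
      have h2 := congrArg (fun φ => φ.hom y) hw
      exact ⟨_, h2⟩
    have hF : IsField (rl.image.presheaf.stalk (g (closedPoint K))) := by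
      rw [hpt]
      exact Field.toIsField _
    letI := hF.toField
    exact isIso_of_bijective _ ⟨(Scheme.stalkClosedPointTo g).hom.injective, hsurj⟩
  -- the model
  have hιε : (c ≫ ε.left) ≫ (Motives.projectiveSpace m k).hom = c ≫ Q.hom := by
    rw [Category.assoc, Over.w ε]
  let N : ProjModel k K :=
    { X := rl.image
      π := c ≫ Q.hom
      gen := g
      gen_π := by rw [reassoc_of% hgc, hrQ]
      isIntegral := inferInstance
      isProjectiveOver := ⟨m, Over.homMk (c ≫ ε.left) hιε,
        inferInstanceAs (IsClosedImmersion (c ≫ ε.left))⟩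
      genericPt_eq := hpt
      isIso_stalkClosedPointTo := hiso }
  refine ⟨N, ⟨⟨c ≫ s₁, ?_, ?_⟩⟩, ⟨⟨c ≫ s₂, ?_, ?_⟩⟩⟩
  · change (c ≫ s₁) ≫ M₁.π = c ≫ Q.hom
    rw [Category.assoc, hs₁]
  · change g ≫ c ≫ s₁ = M₁.gen
    rw [reassoc_of% hgc, hr₁]
  · change (c ≫ s₂) ≫ M₂.π = c ≫ Q.hom
    rw [Category.assoc, hs₂]
  · change g ≫ c ≫ s₂ = M₂.gen
    rw [reassoc_of% hgc, hr₂]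

end ProjModel

end Literature.AlgebraicGeometry.Resolution

end
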